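import Literature.Analysis.FluidPDE.ElgindiAngularCorrectorSmooth
import Literature.Analysis.FluidPDE.ElgindiTrigCoefficients
import HarnessLib

/-!
# The angular corrector of Elgindi's profile: the `D_θ`-words ([Elgindi2021] §8.3 Proposition 8.13,
"`|∂_θθΦ̃|_{𝓦^{4,∞}} ≤ C`"; [ElgindiGhoulMasmoudi2021] §2.3.1 (2.10)–(2.12))

Topic `Literature/Analysis/FluidPDE`. Support file (one predicate, everything proved, no named
facts) on the proof path of the named fact
`Literature.Analysis.FluidPDE.Elgindi.ElgindiGhoulMasmoudi2021_stabilityCore`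
(`ElgindiStabilityDecomposition.lean`). T. M. Elgindi, Ann. of Math. 194 (2021) =
arXiv:1904.04795, §8.3 Proposition 8.13 (p. 27): the angular part of `Φ_*` has all its weighted
angular derivatives bounded ("we want to sketch why `∂_θθΦ̃ ∈ 𝓦^{4,∞}`"); Elgindi–Ghoul–Masmoudi,
arXiv:1910.14071, §2.3.1 (p. 9): the velocities `U(Φ_F)`, `V(Φ_F)`, `𝓡(Φ_F)`.

**The closed `D_θ`-system.** For the corrector `χ₁` (`ψ₁ = cos θ·χ₁`) of
`ElgindiAngularCorrector.lean` the flux equation gives, with `D_θ = sin(2θ)∂_θ`,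
`D_θχ₁ = 2 sin θ cos θ·χ₁′`, `D_θχ₁′ = 6 sin²θ·χ₁′ − 2(4−μ₁) sin θ cos θ·χ₁ − 2 sin θ·Γ̄`,
`D_θ(χ₁/sin θ) = 2 cos θ·χ₁′ − 2cos²θ·(χ₁/sin θ)`, `D_θΓ = (2α/3)(1 − 3sin²θ)Γ`: the singular
coefficients `tan θ`, `1/cos θ`, `1/sin θ` of the angular equation are all absorbed by the factor
`sin 2θ`. Hence the class `CorrRep` of families
`A·χ₁ + B·χ₁′ + D·(χ₁/sin θ) + P·Γ + c·Q + S` (`A, …, S` trigonometric coefficient functions of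
`(α, θ)`, `c = profileConst α`) is **closed under `D_θ`** (`CorrRep.Dθ₁`), every member is bounded
uniformly in `0 < α ≤ 1/200` (`CorrRep.bounded`), and so are all its `D_θ`-iterates
(`CorrRep.iterate`); moreover `D_θ^i(sin 2θ·g) = sin 2θ·gᵢ` with `gᵢ` in the class
(`CorrRep.iterate_sin_mul`). Consequences recorded for the velocities of `Φ_*`:
all `D_θ`-words of `χ₁/sin θ` (`= 2ψ₁/sin 2θ`), of `sin θχ₁`, `cos θχ₁′` are bounded, and the words of
`ψ₁` and of `v₁ = ψ₁′ − tan θψ₁ = cos θχ₁′ − 2 sin θχ₁` of positive order are `O(sin 2θ)`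
(`abs_iterate_Dθ₁_psiOne_le`, `abs_iterate_Dθ₁_vOne_le`), uniformly in `α`.
-/

noncomputable section

open Set Real Filter
open _root_.Topology

namespace Literature.Analysis.FluidPDE

namespace Elgindi

/-! ### The representation class -/

/-- **Families represented through the corrector**: on `0 < α ≤ 1/200`, `θ ∈ (0, π/2)`,
`f(α,θ) = Aχ₁ + Bχ₁′ + D(χ₁/sin θ) + PΓ + cQ + S` with trigonometric coefficient functions
`A, B, D, P, Q, S`. [folklore] -/
def CorrRep (f : ℝ → ℝ → ℝ) : Prop :=
  ∃ A B D P Q S : ℝ → ℝ → ℝ, IsTrig₂ A ∧ IsTrig₂ B ∧ IsTrig₂ D ∧ IsTrig₂ P ∧ IsTrig₂ Q ∧ IsTrig₂ S ∧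
    ∀ α : ℝ, 0 < α → α ≤ 1 / 200 → ∀ θ ∈ Ioo 0 (π / 2),
      f α θ = A α θ * chiOne α θ + B α θ * chiOneD α θ + D α θ * (chiOne α θ / Real.sin θ) +
        P α θ * angularWeight α θ + profileConst α * Q α θ + S α θ

namespace CorrRep

/-- Families agreeing on the domain have the same representations. [folklore] -/
theorem congr {f g : ℝ → ℝ → ℝ} (hf : CorrRep f)
    (h : ∀ α : ℝ, 0 < α → α ≤ 1 / 200 → ∀ θ ∈ Ioo 0 (π / 2), g α θ = f α θ) : CorrRep g := by
  obtain ⟨A, B, D, P, Q, S, hA, hB, hD, hP, hQ, hS, hf⟩ := hf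
  exact ⟨A, B, D, P, Q, S, hA, hB, hD, hP, hQ, hS, fun α hα hα' θ hθ => (h α hα hα' θ hθ).trans (hf α hα hα' θ hθ)⟩

/-- Sums. [folklore] -/
theorem add {f g : ℝ → ℝ → ℝ} (hf : CorrRep f) (hg : CorrRep g) : CorrRep fun α θ => f α θ + g α θ := by
  obtain ⟨A, B, D, P, Q, S, hA, hB, hD, hP, hQ, hS, hf⟩ := hf
  obtain ⟨A', B', D', P', Q', S', hA', hB', hD', hP', hQ', hS', hg⟩ := hg
  refine ⟨fun α θ => A α θ + A' α θ, fun α θ => B α θ + B' α θ, fun α θ => D α θ + D' α θ, fun α θ => P α θ + P' α θ,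
    fun α θ => Q α θ + Q' α θ, fun α θ => S α θ + S' α θ, hA.add hA', hB.add hB', hD.add hD', hP.add hP', hQ.add hQ', hS.add hS',
    fun α hα hα' θ hθ => ?_⟩
  beta_reduce
  rw [hf α hα hα' θ hθ, hg α hα hα' θ hθ]; ring

/-- Products with trigonometric coefficient functions. [folklore] -/
theorem trig_mul {f T : ℝ → ℝ → ℝ} (hT : IsTrig₂ T) (hf : CorrRep f) : CorrRep fun α θ => T α θ * f α θ := by
  obtain ⟨A, B, D, P, Q, S, hA, hB, hD, hP, hQ, hS, hf⟩ := hf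
  refine ⟨fun α θ => T α θ * A α θ, fun α θ => T α θ * B α θ, fun α θ => T α θ * D α θ, fun α θ => T α θ * P α θ,
    fun α θ => T α θ * Q α θ, fun α θ => T α θ * S α θ, hT.mul hA, hT.mul hB, hT.mul hD, hT.mul hP, hT.mul hQ, hT.mul hS,
    fun α hα hα' θ hθ => ?_⟩
  beta_reduce
  rw [hf α hα hα' θ hθ]; ring

/-- Scalar multiples. [folklore] -/
theorem const_mul {f : ℝ → ℝ → ℝ} (hf : CorrRep f) (c : ℝ) : CorrRep fun α θ => c * f α θ :=
  hf.trig_mul (IsTrig₂.const c)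

/-- Differences. [folklore] -/
theorem sub {f g : ℝ → ℝ → ℝ} (hf : CorrRep f) (hg : CorrRep g) : CorrRep fun α θ => f α θ - g α θ := by
  have h := hf.add (hg.const_mul (-1))
  exact h.congr fun α _ _ θ _ => by ring

/-- Trigonometric coefficient functions themselves. [folklore] -/
theorem of_isTrig₂ {T : ℝ → ℝ → ℝ} (hT : IsTrig₂ T) : CorrRep T :=
  ⟨fun _ _ => 0, fun _ _ => 0, fun _ _ => 0, fun _ _ => 0, fun _ _ => 0, T, IsTrig₂.const 0, IsTrig₂.const 0, IsTrig₂.const 0,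
    IsTrig₂.const 0, IsTrig₂.const 0, hT, fun α _ _ θ _ => by ring⟩

end CorrRep

/-- `χ₁` is represented. [folklore] -/
theorem corrRep_chiOne : CorrRep fun α θ => chiOne α θ :=
  ⟨fun _ _ => 1, fun _ _ => 0, fun _ _ => 0, fun _ _ => 0, fun _ _ => 0, fun _ _ => 0, IsTrig₂.const 1, IsTrig₂.const 0,
    IsTrig₂.const 0, IsTrig₂.const 0, IsTrig₂.const 0, IsTrig₂.const 0, fun α _ _ θ _ => by ring⟩

/-- `χ₁′` is represented. [folklore] -/
theorem corrRep_chiOneD : CorrRep fun α θ => chiOneD α θ :=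
  ⟨fun _ _ => 0, fun _ _ => 1, fun _ _ => 0, fun _ _ => 0, fun _ _ => 0, fun _ _ => 0, IsTrig₂.const 0, IsTrig₂.const 1,
    IsTrig₂.const 0, IsTrig₂.const 0, IsTrig₂.const 0, IsTrig₂.const 0, fun α _ _ θ _ => by ring⟩

/-- `χ₁/sin θ` is represented. [folklore] -/
theorem corrRep_chiOne_div_sin : CorrRep fun α θ => chiOne α θ / Real.sin θ :=
  ⟨fun _ _ => 0, fun _ _ => 0, fun _ _ => 1, fun _ _ => 0, fun _ _ => 0, fun _ _ => 0, IsTrig₂.const 0, IsTrig₂.const 0,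
    IsTrig₂.const 1, IsTrig₂.const 0, IsTrig₂.const 0, IsTrig₂.const 0, fun α _ _ θ _ => by ring⟩

/-- `Γ` is represented. [folklore] -/
theorem corrRep_angularWeight : CorrRep fun α θ => angularWeight α θ :=
  ⟨fun _ _ => 0, fun _ _ => 0, fun _ _ => 0, fun _ _ => 1, fun _ _ => 0, fun _ _ => 0, IsTrig₂.const 0, IsTrig₂.const 0,
    IsTrig₂.const 0, IsTrig₂.const 1, IsTrig₂.const 0, IsTrig₂.const 0, fun α _ _ θ _ => by ring⟩

/-- `Γ̄ = Γ − (5/4)c sin 2θ` is represented. [folklore] -/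
theorem corrRep_gammaBar : CorrRep fun α θ => gammaBar α θ :=
  ⟨fun _ _ => 0, fun _ _ => 0, fun _ _ => 0, fun _ _ => 1, fun _ θ => -(5 / 4) * (2 * Real.sin θ * Real.cos θ), fun _ _ => 0,
    IsTrig₂.const 0, IsTrig₂.const 0, IsTrig₂.const 0, IsTrig₂.const 1, ((IsTrig₂.sin.const_mul 2).mul IsTrig₂.cos).const_mul _,
    IsTrig₂.const 0, fun α _ _ θ _ => by simp only [gammaBar]; rw [Real.sin_two_mul]; ring⟩

/-- `μ₁ = −α(α+5)` as a trigonometric coefficient function. [folklore] -/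
theorem isTrig₂_muOne : IsTrig₂ fun α _ => muOne α := by
  have h : IsTrig₂ fun α (θ : ℝ) => -(α * (α + 5)) := (IsTrig₂.alpha.mul (IsTrig₂.alpha.add (IsTrig₂.const 5))).neg
  exact h

/-! ### Closure under `D_θ` -/

/-- Iterates of `D_θ` only see the open quarter. [folklore] -/
theorem iterate_Dθ₁_congr_Ioo {f g : ℝ → ℝ} (h : ∀ θ ∈ Ioo 0 (π / 2), f θ = g θ) (i : ℕ) {θ : ℝ} (hθ : θ ∈ Ioo 0 (π / 2)) :
    (Dθ₁^[i] f) θ = (Dθ₁^[i] g) θ := by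
  induction i generalizing f g with
  | zero => exact h θ hθ
  | succ i ih =>
    rw [Function.iterate_succ_apply, Function.iterate_succ_apply]
    exact ih (fun θ' hθ' => Dθ₁_congr_Ioo h hθ')

/-- The derivative of `χ₁/sin θ` in the open quarter. [folklore] -/
theorem hasDerivAt_chiOne_div_sin {α : ℝ} (hα : 0 < α) (hα' : α ≤ 1 / 200) {θ : ℝ} (hθ : θ ∈ Ioo 0 (π / 2)) :
    HasDerivAt (fun θ' => chiOne α θ' / Real.sin θ')
      ((chiOneD α θ * Real.sin θ - chiOne α θ * Real.cos θ) / Real.sin θ ^ 2) θ := by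
  have hs : Real.sin θ ≠ 0 := (Real.sin_pos_of_pos_of_lt_pi hθ.1 (by linarith [hθ.2, Real.pi_pos])).ne'
  exact (hasDerivAt_chiOne hα hα' hθ).fun_div (Real.hasDerivAt_sin θ) hs

/-- **`CorrRep` is closed under `D_θ = sin(2θ)∂_θ`** (the closed first-order system of the
corrector). [cite: Elgindi2021, §8.3 proof of Proposition 8.13 (p. 27 of arXiv:1904.04795): "we want to sketch why ∂_θθΦ̃ ∈ 𝓦^{4,∞}"] -/
theorem CorrRep.dTheta {f : ℝ → ℝ → ℝ} (hf : CorrRep f) : CorrRep fun α θ => Dθ₁ (f α) θ := by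
  obtain ⟨A, B, D, P, Q, S, hA, hB, hD, hP, hQ, hS, hf⟩ := hf
  obtain ⟨A', hA', eA⟩ := hA.hasDθ₁
  obtain ⟨B', hB', eB⟩ := hB.hasDθ₁
  obtain ⟨D', hD', eD⟩ := hD.hasDθ₁
  obtain ⟨P', hP', eP⟩ := hP.hasDθ₁
  obtain ⟨Q', hQ', eQ⟩ := hQ.hasDθ₁
  obtain ⟨S', hS', eS⟩ := hS.hasDθ₁
  have hM := isTrig₂_muOne
  -- the new coefficients
  refine ⟨fun α θ => A' α θ - 2 * (4 - muOne α) * Real.sin θ * Real.cos θ * B α θ,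
    fun α θ => 2 * Real.sin θ * Real.cos θ * A α θ + B' α θ + 6 * (Real.sin θ * Real.sin θ) * B α θ + 2 * Real.cos θ * D α θ,
    fun α θ => D' α θ - 2 * (Real.cos θ * Real.cos θ) * D α θ,
    fun α θ => -(2 * Real.sin θ * B α θ) + P' α θ + 2 / 3 * α * (1 - 3 * (Real.sin θ * Real.sin θ)) * P α θ,
    fun α θ => 5 * (Real.sin θ * Real.sin θ) * Real.cos θ * B α θ + Q' α θ,
    S',
    hA'.sub ((((((IsTrig₂.const 4).sub hM).const_mul 2).mul IsTrig₂.sin).mul IsTrig₂.cos).mul hB),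
    (((((IsTrig₂.sin.const_mul 2).mul IsTrig₂.cos).mul hA).add hB').add (((IsTrig₂.sin.mul IsTrig₂.sin).const_mul 6).mul hB)).add
      ((IsTrig₂.cos.const_mul 2).mul hD),
    hD'.sub (((IsTrig₂.cos.mul IsTrig₂.cos).const_mul 2).mul hD),
    (((IsTrig₂.sin.const_mul 2).mul hB).neg.add hP').add
      (((IsTrig₂.alpha.const_mul (2 / 3)).mul ((IsTrig₂.const 1).sub ((IsTrig₂.sin.mul IsTrig₂.sin).const_mul 3))).mul hP),
    ((((IsTrig₂.sin.mul IsTrig₂.sin).const_mul 5).mul IsTrig₂.cos).mul hB).add hQ',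
    hS', fun α hα hα' θ hθ => ?_⟩
  beta_reduce
  -- the identity on the open quarter
  have hs0 : Real.sin θ ≠ 0 := (Real.sin_pos_of_pos_of_lt_pi hθ.1 (by linarith [hθ.2, Real.pi_pos])).ne'
  have hc0 : Real.cos θ ≠ 0 := (Real.cos_pos_of_mem_Ioo ⟨by linarith [hθ.1, Real.pi_pos], hθ.2⟩).ne'
  -- the representative of `f α` near `θ`
  set g : ℝ → ℝ := fun θ' => A α θ' * chiOne α θ' + B α θ' * chiOneD α θ' + D α θ' * (chiOne α θ' / Real.sin θ') +
    P α θ' * angularWeight α θ' + profileConst α * Q α θ' + S α θ' with hg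
  have hfg : ∀ θ' ∈ Ioo (0:ℝ) (π / 2), f α θ' = g θ' := fun θ' hθ' => hf α hα hα' θ' hθ'
  rw [Dθ₁_congr_Ioo hfg hθ]
  -- derivative of the representative
  have dA := (hA.differentiableAt α θ).hasDerivAt
  have dB := (hB.differentiableAt α θ).hasDerivAt
  have dD := (hD.differentiableAt α θ).hasDerivAt
  have dP := (hP.differentiableAt α θ).hasDerivAt
  have dQ := (hQ.differentiableAt α θ).hasDerivAt
  have dS := (hS.differentiableAt α θ).hasDerivAt
  have dχ := hasDerivAt_chiOne hα hα' hθ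
  have dχD := hasDerivAt_chiOneD hα hα' hθ
  have dZ := hasDerivAt_chiOne_div_sin hα hα' hθ
  have dΓ := (hasDerivAt_angularWeight α hθ)
  set Γ' := deriv (angularWeight α) θ with hΓ'
  have dΓ' : HasDerivAt (angularWeight α) Γ' θ := by rw [hΓ', dΓ.deriv]; exact dΓ
  have hderiv : HasDerivAt g
      (deriv (A α) θ * chiOne α θ + A α θ * chiOneD α θ +
        (deriv (B α) θ * chiOneD α θ + B α θ * (3 * Real.tan θ * chiOneD α θ - (4 - muOne α) * chiOne α θ - gammaBar α θ / Real.cos θ)) +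
        (deriv (D α) θ * (chiOne α θ / Real.sin θ) + D α θ * ((chiOneD α θ * Real.sin θ - chiOne α θ * Real.cos θ) / Real.sin θ ^ 2)) +
        (deriv (P α) θ * angularWeight α θ + P α θ * Γ') +
        profileConst α * deriv (Q α) θ + deriv (S α) θ) θ := by
    have h := (((((dA.fun_mul dχ).fun_add (dB.fun_mul dχD)).fun_add (dD.fun_mul dZ)).fun_add (dP.fun_mul dΓ')).fun_add
      (dQ.const_mul (profileConst α))).fun_add dS
    exact h
  rw [Dθ₁_apply, hderiv.deriv]
  -- the `D_θ` of the coefficients and of `Γ`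
  have kA : Real.sin (2 * θ) * deriv (A α) θ = A' α θ := by rw [← Dθ₁_apply]; exact eA α θ
  have kB : Real.sin (2 * θ) * deriv (B α) θ = B' α θ := by rw [← Dθ₁_apply]; exact eB α θ
  have kD : Real.sin (2 * θ) * deriv (D α) θ = D' α θ := by rw [← Dθ₁_apply]; exact eD α θ
  have kP : Real.sin (2 * θ) * deriv (P α) θ = P' α θ := by rw [← Dθ₁_apply]; exact eP α θ
  have kQ : Real.sin (2 * θ) * deriv (Q α) θ = Q' α θ := by rw [← Dθ₁_apply]; exact eQ α θ
  have kS : Real.sin (2 * θ) * deriv (S α) θ = S' α θ := by rw [← Dθ₁_apply]; exact eS α θ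
  have kΓ : Real.sin (2 * θ) * Γ' = 2 * α / 3 * (1 - 3 * Real.sin θ ^ 2) * angularWeight α θ := by
    rw [hΓ']; exact sin_two_mul_mul_deriv_angularWeight α hθ
  -- expand and compare
  have e2 : Real.sin (2 * θ) = 2 * Real.sin θ * Real.cos θ := Real.sin_two_mul θ
  simp only [gammaBar]
  rw [Real.tan_eq_sin_div_cos]
  -- isolate the products `sin(2θ)·deriv(·)` before clearing denominators
  have E : Real.sin (2 * θ) *
      (deriv (A α) θ * chiOne α θ + A α θ * chiOneD α θ +
        (deriv (B α) θ * chiOneD α θ + B α θ * (3 * (Real.sin θ / Real.cos θ) * chiOneD α θ - (4 - muOne α) * chiOne α θ -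
          (angularWeight α θ - 5 / 4 * profileConst α * Real.sin (2 * θ)) / Real.cos θ)) +
        (deriv (D α) θ * (chiOne α θ / Real.sin θ) + D α θ * ((chiOneD α θ * Real.sin θ - chiOne α θ * Real.cos θ) / Real.sin θ ^ 2)) +
        (deriv (P α) θ * angularWeight α θ + P α θ * Γ') +
        profileConst α * deriv (Q α) θ + deriv (S α) θ) =
      (Real.sin (2 * θ) * deriv (A α) θ) * chiOne α θ + Real.sin (2 * θ) * A α θ * chiOneD α θ +
        ((Real.sin (2 * θ) * deriv (B α) θ) * chiOneD α θ + B α θ * (3 * (Real.sin (2 * θ) * Real.sin θ / Real.cos θ) * chiOneD α θ -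
          (4 - muOne α) * Real.sin (2 * θ) * chiOne α θ - Real.sin (2 * θ) * (angularWeight α θ - 5 / 4 * profileConst α * Real.sin (2 * θ)) / Real.cos θ)) +
        ((Real.sin (2 * θ) * deriv (D α) θ) * (chiOne α θ / Real.sin θ) + D α θ * (Real.sin (2 * θ) * (chiOneD α θ * Real.sin θ - chiOne α θ * Real.cos θ) / Real.sin θ ^ 2)) +
        ((Real.sin (2 * θ) * deriv (P α) θ) * angularWeight α θ + P α θ * (Real.sin (2 * θ) * Γ')) +
        profileConst α * (Real.sin (2 * θ) * deriv (Q α) θ) + Real.sin (2 * θ) * deriv (S α) θ := by ring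
  rw [E, kA, kB, kD, kP, kQ, kS, kΓ, e2]
  field_simp
  ring

/-! ### Boundedness and iterates -/

/-- **Every represented family is bounded, uniformly in `0 < α ≤ 1/200`.** [folklore] -/
theorem CorrRep.bounded {f : ℝ → ℝ → ℝ} (hf : CorrRep f) :
    ∃ C : ℝ, 0 ≤ C ∧ ∀ α : ℝ, 0 < α → α ≤ 1 / 200 → ∀ θ ∈ Ioo 0 (π / 2), |f α θ| ≤ C := by
  obtain ⟨A, B, D, P, Q, S, hA, hB, hD, hP, hQ, hS, hf⟩ := hf
  obtain ⟨CA, hCA, bA⟩ := hA.bounded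
  obtain ⟨CB, hCB, bB⟩ := hB.bounded
  obtain ⟨CD, hCD, bD⟩ := hD.bounded
  obtain ⟨CP, hCP, bP⟩ := hP.bounded
  obtain ⟨CQ, hCQ, bQ⟩ := hQ.bounded
  obtain ⟨CS, hCS, bS⟩ := hS.bounded
  refine ⟨CA * 300 + CB * 300 + CD * 480 + CP * 1 + 1 * CQ + CS, by positivity, fun α hα hα' θ hθ => ?_⟩
  have hα1 : α ∈ Icc (0:ℝ) 1 := ⟨hα.le, by linarith⟩
  rw [hf α hα hα' θ hθ]
  have h1 := abs_chiOne_le hα hα' θ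
  have h2 := abs_chiOneD_le hα hα' hθ
  have h3 := abs_chiOne_div_sin_le hα hα' hθ
  have h4 : |angularWeight α θ| ≤ 1 := by
    rw [abs_of_nonneg (angularWeight_nonneg α (Ioo_subset_Icc_self hθ))]
    exact angularWeight_le_one hα.le (Ioo_subset_Icc_self hθ)
  have h5 : |profileConst α| ≤ 1 := by
    rw [abs_of_nonneg (profileConst_pos hα.le).le]; exact profileConst_le_one hα.le
  have t1 : |A α θ * chiOne α θ| ≤ CA * 300 := by rw [abs_mul]; exact mul_le_mul (bA α hα1 θ) h1 (abs_nonneg _) hCA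
  have t2 : |B α θ * chiOneD α θ| ≤ CB * 300 := by rw [abs_mul]; exact mul_le_mul (bB α hα1 θ) h2 (abs_nonneg _) hCB
  have t3 : |D α θ * (chiOne α θ / Real.sin θ)| ≤ CD * 480 := by rw [abs_mul]; exact mul_le_mul (bD α hα1 θ) h3 (abs_nonneg _) hCD
  have t4 : |P α θ * angularWeight α θ| ≤ CP * 1 := by rw [abs_mul]; exact mul_le_mul (bP α hα1 θ) h4 (abs_nonneg _) hCP
  have t5 : |profileConst α * Q α θ| ≤ 1 * CQ := by rw [abs_mul]; exact mul_le_mul h5 (bQ α hα1 θ) (abs_nonneg _) zero_le_one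
  have t6 : |S α θ| ≤ CS := bS α hα1 θ
  calc |A α θ * chiOne α θ + B α θ * chiOneD α θ + D α θ * (chiOne α θ / Real.sin θ) + P α θ * angularWeight α θ + profileConst α * Q α θ + S α θ|
      ≤ |A α θ * chiOne α θ| + |B α θ * chiOneD α θ| + |D α θ * (chiOne α θ / Real.sin θ)| + |P α θ * angularWeight α θ| + |profileConst α * Q α θ| + |S α θ| := by
        have e1 := abs_add_le (A α θ * chiOne α θ + B α θ * chiOneD α θ + D α θ * (chiOne α θ / Real.sin θ) + P α θ * angularWeight α θ + profileConst α * Q α θ) (S α θ)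
        have e2 := abs_add_le (A α θ * chiOne α θ + B α θ * chiOneD α θ + D α θ * (chiOne α θ / Real.sin θ) + P α θ * angularWeight α θ) (profileConst α * Q α θ)
        have e3 := abs_add_le (A α θ * chiOne α θ + B α θ * chiOneD α θ + D α θ * (chiOne α θ / Real.sin θ)) (P α θ * angularWeight α θ)
        have e4 := abs_add_le (A α θ * chiOne α θ + B α θ * chiOneD α θ) (D α θ * (chiOne α θ / Real.sin θ))
        have e5 := abs_add_le (A α θ * chiOne α θ) (B α θ * chiOneD α θ)
        linarith
    _ ≤ CA * 300 + CB * 300 + CD * 480 + CP * 1 + 1 * CQ + CS := by linarith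

/-- **All `D_θ`-iterates of a represented family are represented.** [folklore] -/
theorem CorrRep.iterate {f : ℝ → ℝ → ℝ} (hf : CorrRep f) (i : ℕ) : CorrRep fun α θ => (Dθ₁^[i] (f α)) θ := by
  induction i with
  | zero => exact hf.congr fun α _ _ θ _ => by simp
  | succ i ih =>
    have h := ih.dTheta
    exact h.congr fun α _ _ θ _ => by rw [Function.iterate_succ_apply']

/-- **Uniform bounds for the `D_θ`-words of a represented family.** [folklore] -/
theorem CorrRep.abs_iterate_le {f : ℝ → ℝ → ℝ} (hf : CorrRep f) (i : ℕ) :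
    ∃ C : ℝ, 0 ≤ C ∧ ∀ α : ℝ, 0 < α → α ≤ 1 / 200 → ∀ θ ∈ Ioo 0 (π / 2), |(Dθ₁^[i] (f α)) θ| ≤ C :=
  (hf.iterate i).bounded

/-- Represented families are differentiable in the open quarter. [folklore] -/
theorem CorrRep.differentiableAt {f : ℝ → ℝ → ℝ} (hf : CorrRep f) {α : ℝ} (hα : 0 < α) (hα' : α ≤ 1 / 200)
    {θ : ℝ} (hθ : θ ∈ Ioo 0 (π / 2)) : DifferentiableAt ℝ (f α) θ := by
  obtain ⟨A, B, D, P, Q, S, hA, hB, hD, hP, hQ, hS, hf⟩ := hf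
  have hd : DifferentiableAt ℝ (fun θ' => A α θ' * chiOne α θ' + B α θ' * chiOneD α θ' + D α θ' * (chiOne α θ' / Real.sin θ') +
      P α θ' * angularWeight α θ' + profileConst α * Q α θ' + S α θ') θ := by
    have dχ := (hasDerivAt_chiOne hα hα' hθ).differentiableAt
    have dχD := (hasDerivAt_chiOneD hα hα' hθ).differentiableAt
    have dZ := (hasDerivAt_chiOne_div_sin hα hα' hθ).differentiableAt
    have dΓ := (hasDerivAt_angularWeight α hθ).differentiableAt
    exact ((((((hA.differentiableAt α θ).mul dχ).add ((hB.differentiableAt α θ).mul dχD)).add ((hD.differentiableAt α θ).mul dZ)).add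
      ((hP.differentiableAt α θ).mul dΓ)).add ((hQ.differentiableAt α θ).const_mul _)).add (hS.differentiableAt α θ)
  refine hd.congr_of_eventuallyEq ?_
  filter_upwards [isOpen_Ioo.mem_nhds hθ] with θ' hθ'
  exact hf α hα hα' θ' hθ'

/-- **`D_θ^i(sin 2θ·g) = sin 2θ·gᵢ` with `gᵢ` represented**: the factor `sin 2θ` survives all
`D_θ`-iterates (`D_θ sin 2θ = 2cos 2θ·sin 2θ`). [folklore] -/
theorem CorrRep.iterate_sin_mul {g : ℝ → ℝ → ℝ} (hg : CorrRep g) (i : ℕ) :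
    ∃ gi : ℝ → ℝ → ℝ, CorrRep gi ∧ ∀ α : ℝ, 0 < α → α ≤ 1 / 200 → ∀ θ ∈ Ioo 0 (π / 2),
      (Dθ₁^[i] (fun θ' => Real.sin (2 * θ') * g α θ')) θ = Real.sin (2 * θ) * gi α θ := by
  induction i with
  | zero => exact ⟨g, hg, fun α _ _ θ _ => by simp⟩
  | succ i ih =>
    obtain ⟨gi, hgi, hiter⟩ := ih
    refine ⟨fun α θ => 2 * (Real.cos θ * Real.cos θ - Real.sin θ * Real.sin θ) * gi α θ + Dθ₁ (gi α) θ,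
      (hgi.trig_mul ((IsTrig₂.cos.mul IsTrig₂.cos).sub (IsTrig₂.sin.mul IsTrig₂.sin) |>.const_mul 2)).add hgi.dTheta,
      fun α hα hα' θ hθ => ?_⟩
    rw [Function.iterate_succ_apply', Dθ₁_congr_Ioo (fun θ' hθ' => hiter α hα hα' θ' hθ') hθ]
    have hd : HasDerivAt (fun θ' => Real.sin (2 * θ') * gi α θ')
        (Real.cos (2 * θ) * (2 * 1) * gi α θ + Real.sin (2 * θ) * deriv (gi α) θ) θ := by
      have h1 : HasDerivAt (fun θ' => Real.sin (2 * θ')) (Real.cos (2 * θ) * (2 * 1)) θ :=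
        (Real.hasDerivAt_sin (2 * θ)).comp θ ((hasDerivAt_id θ).const_mul 2)
      exact h1.fun_mul (hgi.differentiableAt hα hα' hθ).hasDerivAt
    have hsc : Real.sin θ ^ 2 + Real.cos θ ^ 2 = 1 := Real.sin_sq_add_cos_sq θ
    beta_reduce
    rw [Dθ₁_apply, hd.deriv, Dθ₁_apply, Real.cos_two_mul]
    linear_combination (2 * Real.sin (2 * θ) * gi α θ) * hsc

/-! ### The words of `ψ₁`, `v₁ = ψ₁′ − tan θψ₁`, `χ₁/sin θ` -/

section words

/-- **All `D_θ`-words of `χ₁/sin θ = 2ψ₁/sin 2θ` are bounded** (the angular velocity factor of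
`U(Φ_*)/sin 2θ`). [cite: ElgindiGhoulMasmoudi2021, §2.3.1 (2.10) (p. 9 of arXiv:1910.14071): U(Φ_F) = −3 sin(2θ)/(1+y) + O(α)] -/
theorem abs_iterate_Dθ₁_chiOne_div_sin_le (i : ℕ) :
    ∃ C : ℝ, 0 ≤ C ∧ ∀ α : ℝ, 0 < α → α ≤ 1 / 200 → ∀ θ ∈ Ioo 0 (π / 2),
      |(Dθ₁^[i] (fun θ' => chiOne α θ' / Real.sin θ')) θ| ≤ C :=
  corrRep_chiOne_div_sin.abs_iterate_le i

/-- **All `D_θ`-words of `sin θ·χ₁` and `cos θ·χ₁′` are bounded** (the factors of `𝓡(Φ_*)`). [cite: ElgindiGhoulMasmoudi2021, §2.3.1 (2.12) (p. 9 of arXiv:1910.14071): 𝓡(Φ_F) = 2/(1+y) + O(α)] -/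
theorem abs_iterate_Dθ₁_reaction_le (i : ℕ) :
    ∃ C : ℝ, 0 ≤ C ∧ ∀ α : ℝ, 0 < α → α ≤ 1 / 200 → ∀ θ ∈ Ioo 0 (π / 2),
      |(Dθ₁^[i] (fun θ' => Real.sin θ' * chiOne α θ')) θ| ≤ C ∧ |(Dθ₁^[i] (fun θ' => Real.cos θ' * chiOneD α θ')) θ| ≤ C := by
  obtain ⟨C₁, h₁, b₁⟩ := (corrRep_chiOne.trig_mul IsTrig₂.sin).abs_iterate_le i
  obtain ⟨C₂, h₂, b₂⟩ := (corrRep_chiOneD.trig_mul IsTrig₂.cos).abs_iterate_le i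
  exact ⟨max C₁ C₂, le_max_of_le_left h₁, fun α hα hα' θ hθ =>
    ⟨(b₁ α hα hα' θ hθ).trans (le_max_left _ _), (b₂ α hα hα' θ hθ).trans (le_max_right _ _)⟩⟩

/-- `ψ₁` is represented (`cos θ·χ₁`). [folklore] -/
theorem corrRep_psiOne : CorrRep fun α θ => psiOne α θ :=
  (corrRep_chiOne.trig_mul IsTrig₂.cos).congr fun _ _ _ _ _ => rfl

/-- `ψ₁′ = −sin θχ₁ + cos θχ₁′` is represented. [folklore] -/
theorem corrRep_psiOneD : CorrRep fun α θ => psiOneD α θ :=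
  ((corrRep_chiOne.trig_mul IsTrig₂.sin.neg).add (corrRep_chiOneD.trig_mul IsTrig₂.cos)).congr fun α _ _ θ _ => by
    simp only [psiOneD]

/-- **`D_θψ₁ = sin 2θ·ψ₁′`** in the open quarter. [folklore] -/
theorem Dθ₁_psiOne {α : ℝ} (hα : 0 < α) (hα' : α ≤ 1 / 200) {θ : ℝ} (hθ : θ ∈ Ioo 0 (π / 2)) :
    Dθ₁ (psiOne α) θ = Real.sin (2 * θ) * psiOneD α θ := by
  rw [Dθ₁_apply, deriv_psiOne hα hα' hθ]

/-- **The words of `ψ₁` of positive order vanish to first order at the boundary**: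
`|D_θ^{i+1}ψ₁| ≤ C_i sin 2θ` uniformly in `0 < α ≤ 1/200`. [cite: Elgindi2021, §8.3 Proposition 8.13 (p. 27 of arXiv:1904.04795)] -/
theorem abs_iterate_Dθ₁_psiOne_le (i : ℕ) :
    ∃ C : ℝ, 0 ≤ C ∧ ∀ α : ℝ, 0 < α → α ≤ 1 / 200 → ∀ θ ∈ Ioo 0 (π / 2),
      |(Dθ₁^[i + 1] (psiOne α)) θ| ≤ C * Real.sin (2 * θ) := by
  obtain ⟨gi, hgi, hiter⟩ := corrRep_psiOneD.iterate_sin_mul i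
  obtain ⟨C, hC0, hC⟩ := hgi.bounded
  refine ⟨C, hC0, fun α hα hα' θ hθ => ?_⟩
  have hs : 0 ≤ Real.sin (2 * θ) := (Real.sin_pos_of_pos_of_lt_pi (by linarith [hθ.1]) (by linarith [hθ.2])).le
  have e : (Dθ₁^[i + 1] (psiOne α)) θ = (Dθ₁^[i] (fun θ' => Real.sin (2 * θ') * psiOneD α θ')) θ := by
    rw [Function.iterate_succ_apply]
    exact iterate_Dθ₁_congr_Ioo (fun θ' hθ' => Dθ₁_psiOne hα hα' hθ') i hθ
  rw [e, hiter α hα hα' θ hθ, abs_mul, abs_of_nonneg hs, mul_comm]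
  exact mul_le_mul_of_nonneg_right (hC α hα hα' θ hθ) hs

/-- **The angular velocity factor `v₁ = ψ₁′ − tan θ·ψ₁ = cos θχ₁′ − 2 sin θχ₁`** of `V(Φ_*)`. [cite: ElgindiGhoulMasmoudi2021, §2.3.1 (2.11) (p. 9 of arXiv:1910.14071): V(Φ_F) = (2cos 2θ − 2sin²θ)/(1+y) + O(α)] -/
def vOne (α θ : ℝ) : ℝ := Real.cos θ * chiOneD α θ - 2 * Real.sin θ * chiOne α θ

/-- `v₁ = ψ₁′ − tan θψ₁` in the open quarter. [folklore] -/
theorem vOne_eq {α θ : ℝ} (hθ : θ ∈ Ioo 0 (π / 2)) : vOne α θ = psiOneD α θ - Real.tan θ * psiOne α θ := by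
  have hc0 : Real.cos θ ≠ 0 := (Real.cos_pos_of_mem_Ioo ⟨by linarith [hθ.1, Real.pi_pos], hθ.2⟩).ne'
  simp only [vOne, psiOneD, psiOne]
  rw [Real.tan_eq_sin_div_cos]
  field_simp
  ring

/-- `v₁` is represented. [folklore] -/
theorem corrRep_vOne : CorrRep fun α θ => vOne α θ :=
  ((corrRep_chiOneD.trig_mul IsTrig₂.cos).sub (corrRep_chiOne.trig_mul (IsTrig₂.sin.const_mul 2))).congr fun α _ _ θ _ => by
    simp only [vOne]

/-- **`D_θv₁ = −sin 2θ·((6 − μ₁)cos θχ₁ + Γ̄)`**: the `χ₁′`-terms cancel by the flux equation. [folklore] -/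
theorem Dθ₁_vOne {α : ℝ} (hα : 0 < α) (hα' : α ≤ 1 / 200) {θ : ℝ} (hθ : θ ∈ Ioo 0 (π / 2)) :
    Dθ₁ (vOne α) θ = Real.sin (2 * θ) * (-((6 - muOne α) * Real.cos θ * chiOne α θ + gammaBar α θ)) := by
  have hc0 : Real.cos θ ≠ 0 := (Real.cos_pos_of_mem_Ioo ⟨by linarith [hθ.1, Real.pi_pos], hθ.2⟩).ne'
  have h1 := (Real.hasDerivAt_cos θ).fun_mul (hasDerivAt_chiOneD hα hα' hθ)
  have h2 := ((Real.hasDerivAt_sin θ).const_mul 2).fun_mul (hasDerivAt_chiOne hα hα' hθ)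
  have h := h1.fun_sub h2
  have e : vOne α = fun θ' => Real.cos θ' * chiOneD α θ' - 2 * Real.sin θ' * chiOne α θ' := rfl
  rw [Dθ₁_apply, e, h.deriv, Real.tan_eq_sin_div_cos]
  field_simp
  ring

/-- **The words of `v₁` of positive order vanish to first order at the boundary**:
`|D_θ^{i+1}v₁| ≤ C_i sin 2θ`, and `|v₁| ≤ C₀`, uniformly in `0 < α ≤ 1/200` — the hypothesis of the
`D_z`-transport estimate with a bounded velocity (`ElgindiTransportEstimateSup.lean`). [cite: ElgindiGhoulMasmoudi2021, §2.3.1 (2.11) and §9 Proposition 9.5 (pp. 9, 20 of arXiv:1910.14071)] -/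
theorem abs_iterate_Dθ₁_vOne_le (i : ℕ) :
    ∃ C : ℝ, 0 ≤ C ∧ ∀ α : ℝ, 0 < α → α ≤ 1 / 200 → ∀ θ ∈ Ioo 0 (π / 2),
      |vOne α θ| ≤ C ∧ |(Dθ₁^[i + 1] (vOne α)) θ| ≤ C * Real.sin (2 * θ) := by
  have hG : CorrRep fun α θ => -((6 - muOne α) * Real.cos θ * chiOne α θ + gammaBar α θ) :=
    ((corrRep_chiOne.trig_mul (((IsTrig₂.const 6).sub isTrig₂_muOne).mul IsTrig₂.cos)).add corrRep_gammaBar).const_mul (-1)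
      |>.congr fun α _ _ θ _ => by ring
  obtain ⟨gi, hgi, hiter⟩ := hG.iterate_sin_mul i
  obtain ⟨C, hC0, hC⟩ := hgi.bounded
  obtain ⟨C₀, hC₀, hv⟩ := corrRep_vOne.bounded
  refine ⟨max C C₀, le_max_of_le_left hC0, fun α hα hα' θ hθ => ⟨(hv α hα hα' θ hθ).trans (le_max_right _ _), ?_⟩⟩
  have hs : 0 ≤ Real.sin (2 * θ) := (Real.sin_pos_of_pos_of_lt_pi (by linarith [hθ.1]) (by linarith [hθ.2])).le
  have e : (Dθ₁^[i + 1] (vOne α)) θ = (Dθ₁^[i] (fun θ' => Real.sin (2 * θ') * -((6 - muOne α) * Real.cos θ' * chiOne α θ' + gammaBar α θ'))) θ := by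
    rw [Function.iterate_succ_apply]
    exact iterate_Dθ₁_congr_Ioo (fun θ' hθ' => Dθ₁_vOne hα hα' hθ') i hθ
  rw [e, hiter α hα hα' θ hθ, abs_mul, abs_of_nonneg hs, mul_comm]
  exact mul_le_mul_of_nonneg_right ((hC α hα hα' θ hθ).trans (le_max_left _ _)) hs

end words

end Elgindi

end Literature.Analysis.FluidPDE
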